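import Literature.NumberTheory.DiophantineGeometry.GenEllDeCoverFarFromCuspsFamilyD3
import Literature.NumberTheory.DiophantineGeometry.GenEllDeFibresFamily

/-!
# [GenEll] Thm 2.1 for `ℙ¹` (route piece W7, family `t_c`): the adapter instantiated with W5-F-c's
# finite sets `De.XphiC k c B` (`X = x(t_c⁻¹(B))`)

Support file for `GenEllTwo` (stmt-ABC-19679; S. Mochizuki, *Arithmetic elliptic curves in general
position*, Math. J. Okayama Univ. **52** (2010), Thm. 2.1 (ii) ⇒ (i), proof p. 12; package map
`GENELLTWO-P1ROUTE.md` of seat abc-iut-S6, W7 «properness», RULING #6 «per (c, T)»).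
`GenEllDeCoverFarFromCuspsFamilyD3.exists_farFromCusps_phi_c_of_base` takes ANY finite sets
`Xℂ`, `X₂` containing the `x`-coordinates of the `t_c`-fibre over the roots of `p·q·(p − q)`; here
they are W5-F-c's `De.XphiC k (algebraMap ℚ L c) B` (abc-iut-w5-d015, `GenEllDeFibresFamily`) for
any finite `B ⊂ L` containing those roots (`exists_farFromCusps_phi_c_of_base_XphiC`), in particular
for `B :=` the roots of `p·q·(p − q)` in `L` (`…_XphiC_roots`), and the `hZfar ∧ hZmem` form
(`…_imageAt_mem_UPle_XphiC`).  Classical; nothing here bears on [IUTchIII] Cor. 3.12.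
-/

namespace Literature.NumberTheory.DiophantineGeometry.GenEll

open Polynomial

universe u

section Forms

variable {L : Type u} [Field L] [CharZero L]

/-- A non-pole point of `D_e` whose `t_c`-value is a root of `p`, `q` or `p − q` has its
`x`-coordinate in `De.XphiC k c B` for every finite `B` containing these roots (`c ≠ 0`).
[folklore] -/
private theorem fst_mem_XphiC (k : ℕ) {c : ℚ} (hc : c ≠ 0) {p q : ℚ[X]} {B : Finset L}
    (hB : ∀ z : L, (aeval z p = 0 ∨ aeval z q = 0 ∨ aeval z (p - q) = 0) → z ∈ B)
    (P' : L × L) (hcurve : P'.2 ^ (2 * k + 1) = P'.1 * (1 - P'.1)) (hr : P'.2 ≠ 0)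
    (hs : 1 - 2 * P'.1 ≠ 0)
    (hfib : aeval (((1 - 2 * P'.1) + algebraMap ℚ L c * P'.2 ^ (k + 2)) / (P'.2 * (1 - 2 * P'.1)))
          p = 0 ∨
      aeval (((1 - 2 * P'.1) + algebraMap ℚ L c * P'.2 ^ (k + 2)) / (P'.2 * (1 - 2 * P'.1)))
          q = 0 ∨
      aeval (((1 - 2 * P'.1) + algebraMap ℚ L c * P'.2 ^ (k + 2)) / (P'.2 * (1 - 2 * P'.1)))
          (p - q) = 0) :
    P'.1 ∈ De.XphiC k (algebraMap ℚ L c) B := by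
  have hcL : algebraMap ℚ L c ≠ 0 := (_root_.map_ne_zero _).mpr hc
  rw [De.mem_XphiC]
  exact ⟨P'.2, (De.mem_EphiC_iff_t hcL).mpr ⟨hcurve, hr, hs, hB _ hfib⟩⟩

/-- The roots in `L` of `p·q·(p − q)` contain every root of `p`, of `q` and of `p − q`
(`p, q ≠ 0`, `p ≠ q`). [folklore] -/
private theorem mem_roots_toFinset' [DecidableEq L] {p q : ℚ[X]} (hp0 : p ≠ 0) (hq0 : q ≠ 0)
    (hne : p ≠ q) (z : L) (hz : aeval z p = 0 ∨ aeval z q = 0 ∨ aeval z (p - q) = 0) :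
    z ∈ ((p * q * (p - q)).map (algebraMap ℚ L)).roots.toFinset := by
  have hpq : p * q * (p - q) ≠ 0 := mul_ne_zero (mul_ne_zero hp0 hq0) (sub_ne_zero.mpr hne)
  rw [Multiset.mem_toFinset, mem_roots ((Polynomial.map_ne_zero_iff (algebraMap ℚ L).injective).mpr
    hpq), IsRoot.def, eval_map_algebraMap, map_mul, map_mul, map_sub]
  rcases hz with h | h | h
  · rw [h, zero_mul, zero_mul]
  · rw [h, mul_zero, zero_mul]
  · rw [map_sub] at h
    rw [h, mul_zero]

end Forms

section NumberField

/-- **W7 for the family `t_c`, through W5-F-c's `X = De.XphiC k c B`** (any finite `Bℂ ⊂ ℂ`,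
`B₂ ⊂ ℚ̄₂^∧` containing the roots of `p`, `q`, `p − q`): point-indexed `hZfar` for
`⟨F, β(t_c)⟩`. [cite: MochizukiGenEll2010, Thm 2.1 proof p.12] -/
theorem exists_farFromCusps_phi_c_of_base_XphiC (k : ℕ) {c : ℚ} (hc : c ≠ 0) {p q : ℚ[X]}
    {n : ℕ} (hpn : p.natDegree = n) (hqn : q.natDegree = n) (hpqn : (p - q).natDegree = n)
    (hp0 : p ≠ 0) (hq0 : q ≠ 0) (hne : p ≠ q) {ρ : ℝ} (hρ : 0 < ρ) (N : ℕ) {Bℂ : Finset ℂ}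
    (hBℂ : ∀ z : ℂ, (aeval z p = 0 ∨ aeval z q = 0 ∨ aeval z (p - q) = 0) → z ∈ Bℂ)
    {B₂ : Finset (PadicAlgCl 2)}
    (hB₂ : ∀ z : PadicAlgCl 2, (aeval z p = 0 ∨ aeval z q = 0 ∨ aeval z (p - q) = 0) → z ∈ B₂) :
    ∃ ρ' : ℝ, 0 < ρ' ∧ ρ' ≤ 1 / 2 ∧
      ∀ P : NFPoint,
        (∀ σ : P.F →+* ℂ, ∀ ξ ∈ De.XphiC k (algebraMap ℚ ℂ c) Bℂ, ρ ≤ dist (σ P.x) ξ) →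
        (∀ σ : P.F →+* PadicAlgCl 2, ∀ ξ ∈ De.XphiC k (algebraMap ℚ (PadicAlgCl 2) c) B₂,
          ρ ≤ dist (σ P.x) ξ) →
      ∀ (F : Type) [Field F] [NumberField F], Module.finrank ℚ F ≤ N →
      ∀ (ι : P.F →+* F) (r : F), r ^ (2 * k + 1) = ι P.x * (1 - ι P.x) → r ≠ 0 →
        1 - 2 * ι P.x ≠ 0 →
      NFPoint.FarFromCusps ({2} : Finset ℕ) ρ'
        ⟨F, aeval (((1 - 2 * ι P.x) + algebraMap ℚ F c * r ^ (k + 2)) / (r * (1 - 2 * ι P.x))) p /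
            aeval (((1 - 2 * ι P.x) + algebraMap ℚ F c * r ^ (k + 2)) / (r * (1 - 2 * ι P.x))) q⟩ :=
  exists_farFromCusps_phi_c_of_base k hc hpn hqn hpqn hp0 hq0 hne hρ N
    (fst_mem_XphiC k hc hBℂ) (fst_mem_XphiC k hc hB₂)

/-- **W7 for the family `t_c`, through `X = De.XphiC k c B` with the canonical `B`** (the roots of
`p·q·(p − q)`, so `De.XphiC k c B = X_φ` exactly). [cite: MochizukiGenEll2010, Thm 2.1 proof p.12] -/
theorem exists_farFromCusps_phi_c_of_base_XphiC_roots (k : ℕ) {c : ℚ} (hc : c ≠ 0) {p q : ℚ[X]}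
    {n : ℕ} (hpn : p.natDegree = n) (hqn : q.natDegree = n) (hpqn : (p - q).natDegree = n)
    (hp0 : p ≠ 0) (hq0 : q ≠ 0) (hne : p ≠ q) {ρ : ℝ} (hρ : 0 < ρ) (N : ℕ) :
    ∃ ρ' : ℝ, 0 < ρ' ∧ ρ' ≤ 1 / 2 ∧
      ∀ P : NFPoint,
        (∀ σ : P.F →+* ℂ, ∀ ξ ∈ De.XphiC k (algebraMap ℚ ℂ c)
            (open scoped Classical in ((p * q * (p - q)).map (algebraMap ℚ ℂ)).roots.toFinset),
          ρ ≤ dist (σ P.x) ξ) →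
        (∀ σ : P.F →+* PadicAlgCl 2, ∀ ξ ∈ De.XphiC k (algebraMap ℚ (PadicAlgCl 2) c)
            (open scoped Classical in
              ((p * q * (p - q)).map (algebraMap ℚ (PadicAlgCl 2))).roots.toFinset),
          ρ ≤ dist (σ P.x) ξ) →
      ∀ (F : Type) [Field F] [NumberField F], Module.finrank ℚ F ≤ N →
      ∀ (ι : P.F →+* F) (r : F), r ^ (2 * k + 1) = ι P.x * (1 - ι P.x) → r ≠ 0 →
        1 - 2 * ι P.x ≠ 0 →
      NFPoint.FarFromCusps ({2} : Finset ℕ) ρ'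
        ⟨F, aeval (((1 - 2 * ι P.x) + algebraMap ℚ F c * r ^ (k + 2)) / (r * (1 - 2 * ι P.x))) p /
            aeval (((1 - 2 * ι P.x) + algebraMap ℚ F c * r ^ (k + 2)) / (r * (1 - 2 * ι P.x))) q⟩ :=
  by
  classical
  exact exists_farFromCusps_phi_c_of_base_XphiC k hc hpn hqn hpqn hp0 hq0 hne hρ N
    (mem_roots_toFinset' hp0 hq0 hne) (mem_roots_toFinset' hp0 hq0 hne)

/-- **W7 for the family `t_c`, through `X = De.XphiC k c B`, `hZfar ∧ hZmem` form** (the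
re-presented point `(⟨F, r⟩ : NFPoint).imageAt (β(t_c))` is `FarFromCusps {2} ρ'` and lies in
`UPle N`). [cite: MochizukiGenEll2010, Thm 2.1 proof p.12] -/
theorem exists_farFromCusps_phi_c_imageAt_mem_UPle_XphiC (k : ℕ) {c : ℚ} (hc : c ≠ 0)
    {p q : ℚ[X]} {n : ℕ} (hpn : p.natDegree = n) (hqn : q.natDegree = n)
    (hpqn : (p - q).natDegree = n) (hp0 : p ≠ 0) (hq0 : q ≠ 0) (hne : p ≠ q) {ρ : ℝ} (hρ : 0 < ρ)
    (N : ℕ) {Bℂ : Finset ℂ}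
    (hBℂ : ∀ z : ℂ, (aeval z p = 0 ∨ aeval z q = 0 ∨ aeval z (p - q) = 0) → z ∈ Bℂ)
    {B₂ : Finset (PadicAlgCl 2)}
    (hB₂ : ∀ z : PadicAlgCl 2, (aeval z p = 0 ∨ aeval z q = 0 ∨ aeval z (p - q) = 0) → z ∈ B₂) :
    ∃ ρ' : ℝ, 0 < ρ' ∧ ρ' ≤ 1 / 2 ∧
      ∀ P : NFPoint,
        (∀ σ : P.F →+* ℂ, ∀ ξ ∈ De.XphiC k (algebraMap ℚ ℂ c) Bℂ, ρ ≤ dist (σ P.x) ξ) →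
        (∀ σ : P.F →+* PadicAlgCl 2, ∀ ξ ∈ De.XphiC k (algebraMap ℚ (PadicAlgCl 2) c) B₂,
          ρ ≤ dist (σ P.x) ξ) →
      ∀ (F : Type) [Field F] [NumberField F], Module.finrank ℚ F ≤ N →
      ∀ (ι : P.F →+* F) (r : F), r ^ (2 * k + 1) = ι P.x * (1 - ι P.x) → r ≠ 0 →
        1 - 2 * ι P.x ≠ 0 →
      NFPoint.FarFromCusps ({2} : Finset ℕ) ρ'
          ((⟨F, r⟩ : NFPoint).imageAt
            (aeval (((1 - 2 * ι P.x) + algebraMap ℚ F c * r ^ (k + 2)) / (r * (1 - 2 * ι P.x))) p /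
              aeval (((1 - 2 * ι P.x) + algebraMap ℚ F c * r ^ (k + 2)) / (r * (1 - 2 * ι P.x)))
                q)) ∧
        (⟨F, r⟩ : NFPoint).imageAt
            (aeval (((1 - 2 * ι P.x) + algebraMap ℚ F c * r ^ (k + 2)) / (r * (1 - 2 * ι P.x))) p /
              aeval (((1 - 2 * ι P.x) + algebraMap ℚ F c * r ^ (k + 2)) / (r * (1 - 2 * ι P.x)))
                q) ∈ UPle N :=
  exists_farFromCusps_phi_c_imageAt_mem_UPle k hc hpn hqn hpqn hp0 hq0 hne hρ N
    (fst_mem_XphiC k hc hBℂ) (fst_mem_XphiC k hc hB₂)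

end NumberField

end Literature.NumberTheory.DiophantineGeometry.GenEll
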